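import Literature.Analysis.FluidPDE.NSRobustnessOfRegularity

/-!
# Robustness of regularity on `ℝ³`: Agmon's inequality with a constant PARAMETER (`AgmonBoundR3 A`)

Analysis/FluidPDE statement-and-proof file (one definition, four small theorems; no named facts, no `sorry`),
a 60-line annex of the vein `NSRobustnessOfRegularity` → `…H2` → `…SupNorm` (RRS 2016 Thm 9.1 / Dashti–Robinson
2008 Thm 1–2 on `ℝ³`). That vein is written with the tree's Agmon constant `agmonConst`
(`NSStrongSpeedBound`; RRS Thm 1.20 `‖w‖_∞ ≤ A‖∇w‖^{1/2}‖Δw‖^{1/2}`), which is built from Mathlib's Sobolev constant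
`SNormLESNormFDerivOfEqConst` (a chosen linear equivalence) and has no provable numerical value; every smallness
hypothesis of the vein (`β₁ = A⁴/(2ν³)`, `Λ₂ ∋ 3A²X₁/(νμ) + 27A⁴X₁²/(16ν³)`, `β₂ = A²μ/ν`, the readout
`A(3X₁·2e^{Λ₂}(D₂+Ψ₂))^{1/4}`) is INCREASING in `A`, so a numerical certificate needs the vein re-threaded over an
Agmon constant given as a PARAMETER. This file supplies the parameter's contract:

* `AgmonBoundR3 A` — `0 ≤ A` and Agmon's inequality on `ℝ³` with constant `A` in the vein's quantities: for every
  `C^∞` field `w : ℝ³ → ℝ³` with all derivatives in `L²`, `‖w(x)‖ ≤ A (∫|∇w|²_F · ∫‖Δw‖²)^{1/4}`;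
* `AgmonBoundR3.nonneg`, `AgmonBoundR3.norm_le`, `AgmonBoundR3.mono` (the contract is monotone in `A`);
* `agmonBoundR3_agmonConst : AgmonBoundR3 agmonConst` — the tree's constant satisfies it
  (`norm_le_agmonConst_mul_rpow`), so every re-threaded theorem specialises back to its current statement.

The EXPLICIT instance `AgmonBoundR3 (√2/π)` is proved Summits-side (cell `ns-blowup`,
`Theorems/PalasekTowerBreakdownEpisodeBaseTAgmonExplicitSobolev`, from the Fourier proof of Agmon's inequality with
the Stein–Weiss constant); it is not restated here. Consumer: route `PalasekTowerBreakdown`, crux `EpisodeBaseT`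
(stmt-NavierStokesRegularity-20303), `H²`-currency certificate letter `StrainDoor.CertificateDataH2`.
WHAT THIS IS NOT: not a statement about Navier–Stokes — a definition packaging a Sobolev inequality and its
instance at the tree's constant.

## References

* J. C. Robinson, J. L. Rodrigo, W. Sadowski, *The Three-Dimensional Navier–Stokes Equations*, CUP 2016,
  Thm 1.20 (Agmon's inequality), Thm 9.1. [RobinsonRodrigoSadowskiCUP2016]
* S. Agmon, *Lectures on Elliptic Boundary Value Problems*, Van Nostrand 1965, §13.
-/

noncomputable section

open MeasureTheory
open scoped ENNReal ContDiff Laplacian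

namespace Literature.Analysis.FluidPDE

/-- **Agmon's inequality on `ℝ³` with constant `A`, as a contract** (RRS 2016, Thm 1.20, constant left as a
parameter): `0 ≤ A`, and for every `C^∞` field `w : ℝ³ → ℝ³` with all derivatives in `L²` and every `x`,
`‖w(x)‖ ≤ A · (∫|∇w|²_F · ∫‖Δw‖²)^{1/4}`. [cite: RobinsonRodrigoSadowskiCUP2016, Thm 1.20] -/
def AgmonBoundR3 (A : ℝ) : Prop :=
  0 ≤ A ∧ ∀ w : EuclideanSpace ℝ (Fin 3) → EuclideanSpace ℝ (Fin 3), ContDiff ℝ ∞ w →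
    (∀ n : ℕ, ∫⁻ x, ‖iteratedFDeriv ℝ n w x‖ₑ ^ 2 < ⊤) →
    ∀ x, ‖w x‖ ≤ A * ((∫ y, frobeniusNormSq (fderiv ℝ w y)) * ∫ y, ‖(Δ w) y‖ ^ 2) ^ (1 / 4 : ℝ)

/-- The constant of an Agmon contract is nonnegative. [cite: RobinsonRodrigoSadowskiCUP2016, Thm 1.20] -/
theorem AgmonBoundR3.nonneg {A : ℝ} (hA : AgmonBoundR3 A) : 0 ≤ A :=
  hA.1

/-- The inequality of an Agmon contract: `‖w(x)‖ ≤ A (∫|∇w|²_F · ∫‖Δw‖²)^{1/4}`.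
[cite: RobinsonRodrigoSadowskiCUP2016, Thm 1.20] -/
theorem AgmonBoundR3.norm_le {A : ℝ} (hA : AgmonBoundR3 A)
    {w : EuclideanSpace ℝ (Fin 3) → EuclideanSpace ℝ (Fin 3)} (hw : ContDiff ℝ ∞ w)
    (hn : ∀ n : ℕ, ∫⁻ x, ‖iteratedFDeriv ℝ n w x‖ₑ ^ 2 < ⊤) (x : EuclideanSpace ℝ (Fin 3)) :
    ‖w x‖ ≤ A * ((∫ y, frobeniusNormSq (fderiv ℝ w y)) * ∫ y, ‖(Δ w) y‖ ^ 2) ^ (1 / 4 : ℝ) :=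
  hA.2 w hw hn x

/-- Agmon contracts are monotone in the constant. [cite: RobinsonRodrigoSadowskiCUP2016, Thm 1.20] -/
theorem AgmonBoundR3.mono {A B : ℝ} (hA : AgmonBoundR3 A) (hAB : A ≤ B) : AgmonBoundR3 B := by
  refine ⟨hA.1.trans hAB, fun w hw hn x => (hA.2 w hw hn x).trans ?_⟩
  exact mul_le_mul_of_nonneg_right hAB (Real.rpow_nonneg (mul_nonneg
    (integral_nonneg fun _ => frobeniusNormSq_nonneg _) (integral_nonneg fun _ => sq_nonneg _)) _)

/-- **The tree's Agmon constant satisfies the contract**: `AgmonBoundR3 agmonConst`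
(`norm_le_agmonConst_mul_rpow`, `agmonConst_nonneg`). [cite: RobinsonRodrigoSadowskiCUP2016, Thm 1.20] -/
theorem agmonBoundR3_agmonConst : AgmonBoundR3 agmonConst :=
  ⟨agmonConst_nonneg, fun _ hw hn x => norm_le_agmonConst_mul_rpow hw (hn 0) (hn 1) (hn 2) (hn 3) x⟩

end Literature.Analysis.FluidPDE

end
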